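import Mathlib
import Summits.Ventures.HodgeRepro.Tier4.Line1.RowPlaneGenuine
import Summits.Ventures.HodgeRepro.Tier4.Line1.CMQuadData
import Summits.Ventures.HodgeRepro.Tier4.Line1.TotallyDefiniteCompact

/-!
# Tier4/Line1/CMPlaneTotallyDefinite — L1's CM seesaw plane `⟨a⟩ ⊕ ⟨b⟩` is TOTALLY DEFINITE when `a, b` have the same
sign at every real place of `E⁺`, so its `K_f(N) × G(k_∞)` is compact and (S1b) holds for the concrete spherical pairs

Blind re-derivation cell `pub-hodge-repro`, Tier 4 (README §9–§10), seat t4-L1-p2 (gen 4), LINE L1.  Target tree path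
`lean/Summits/Ventures/HodgeRepro/Tier4/Line1/CMPlaneTotallyDefinite.lean`.  Imports t4-L1-p3's `RowPlaneGenuine`
(`ofLinesRow_B_eq_diagonal`, the shape of `isDefinite_ofLinesRow`) and `CMQuadData` (`cmQuad`, `cmQuad_t`, `cmQuad_n`,
`cmDelta_pos`), this seat's `TotallyDefiniteCompact` (`IsTotallyDefinite`, `isCompact_finLevel_of_totallyDefinite`,
`exists_spec_of_archCoeff_of_totallyDefinite`) and Mathlib's `isTotallyReal_maximalRealSubfield`.

WHAT THIS IS.  The (S1b) theorems of `TotallyDefiniteCompact` display `IsTotallyDefinite pl`.  On L1's own plane —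
typer-2's row plane `ofLinesRow (cmQuad ω h) a b 1 = ⟨a⟩ ⊕ ⟨b⟩` over `k = E⁺` (t4-L1-p3's CMQuadData) — that
display is an explicit SIGN CONDITION on the line scalars: `a, b ∈ E⁺` of the same sign at EVERY real embedding
`σ : E⁺ →+* ℝ` (the tree's `isDefinite_isGenuineRow_ofLinesRow_cmQuad` asks it at ONE `σ`).  `E⁺` is totally real
(Mathlib), the quadratic datum has `t = 0` and `n = δ` totally positive (`cmDelta_pos`), and the Gram matrix is the
diagonal `diag(2aδ, 2a, 2bδ, 2b)` (`ofLinesRow_B_eq_diagonal`), so each `B.map σ` is `±`-definite: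

* `posDef_or_negDef_ofLinesRow` — the definiteness at `σ` of p3's `isDefinite_ofLinesRow`, stated as the disjunction
  `(B.map σ).PosDef ∨ (-(B.map σ)).PosDef` (the same `posDef_diagonal_iff` proof);
* `isTotallyDefinite_ofLinesRow` — over a totally real `k`, a trace-zero datum with `n` totally positive and `a, εb` of
  the same sign at every `σ`;
* **`isTotallyDefinite_ofLinesRow_cmQuad`** — L1's CM plane under the sign condition; non-vacuity
  `exists_isTotallyDefinite_isGenuineRow`: `⟨1⟩ ⊕ ⟨1⟩` is totally definite and genuine for every CM field;
* the chain on the CM plane: `isCompact_finLevel_cmQuad`, `isTest_indicator_finLevel_cmQuad`, and on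
  `Setting.ofAdelic` **`exists_spec_of_archCoeff_cmQuad`** — (S1b) for the test pairs
  `(1_{K_f(N γ) × G(k_∞)} · (archMat pl (w γ) ·) (i γ) (j γ), f₂)` on L1's plane `⟨a⟩ ⊕ ⟨b⟩`, the only hypothesis beyond
  the shape of the pairs being the sign condition on `a, b`.

HONEST SCOPE.  The sign condition at every real place is STRONGER than the tree's one-place definiteness
(`hpos` at `τ₀` only, DistinguishedPlace): whether the costume's `a, b` can be taken of the same sign everywhere is a
question for the plane's constructors (it is the condition for the hermitian form `⟨a⟩ ⊕ ⟨b⟩` on `E′²` to be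
definite at every place — the «totally definite seesaw plane» p1's HeckeFinitenessType names as the scope of any
open-level Hecke finiteness).  Nothing on (S1a), the dictionary `tf`, (S3′), `P_T4`.  0 print.

JUNK TESTS.  `a` of mixed signs: the hypothesis fails and the conclusion is false (an indefinite place) — content.
`a = b`: allowed, fine.  `ε = 1` only (the seesaw plane; the mixed plane `ε = −1` is never totally definite with
`a, b` of the same sign, and is not L1's).

Nothing here says anything about the status of the Hodge conjecture for CM abelian varieties, which is NOT proved
(HC_CM is NOT proved by anyone in this repository).
-/

set_option autoImplicit false

noncomputable section

namespace Summit.Ventures.HodgeRepro.Tier4.Line1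

open NumberField Common MeasureTheory Topology Matrix

section RowPlane

variable {k : Type} [Field k] (q : QuadData k)

/-- **definiteness at a real embedding of the row plane `⟨a⟩ ⊕ ⟨ε b⟩`** (the content of t4-L1-p3's
`isDefinite_ofLinesRow`, as the disjunction at `σ`): for a trace-zero datum with `0 < σ n` and `a, εb` of the same sign
at `σ`, the real Gram matrix `B.map σ` is positive or negative definite. -/
theorem posDef_or_negDef_ofLinesRow (a b ε : k) (ht : q.t = 0) (σ : k →+* ℝ) (hn : 0 < σ q.n)
    (hpos : (0 < σ a ∧ 0 < σ (ε * b)) ∨ (σ a < 0 ∧ σ (ε * b) < 0)) :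
    ((PlaneData.ofLinesRow q a b ε).B.map σ).PosDef ∨ (-((PlaneData.ofLinesRow q a b ε).B.map σ)).PosDef := by
  rw [ofLinesRow_B_eq_diagonal q a b ε ht, diagonal_map (map_zero σ)]
  rcases hpos with ⟨ha, hb⟩ | ⟨ha, hb⟩ <;> rw [map_mul] at hb
  · left
    have key : ∀ j : Fin 2 ⊕ Fin 2,
        0 < σ (Sum.elim ![a * (2 * q.n), a * 2] ![(ε * b) * (2 * q.n), (ε * b) * 2] j) := by
      rintro (j | j) <;> fin_cases j
      · show 0 < σ (a * (2 * q.n))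
        simp only [map_mul, map_ofNat]
        exact mul_pos ha (by linarith)
      · show 0 < σ (a * 2)
        simp only [map_mul, map_ofNat]
        exact mul_pos ha (by norm_num)
      · show 0 < σ ((ε * b) * (2 * q.n))
        simp only [map_mul, map_ofNat]
        exact mul_pos hb (by linarith)
      · show 0 < σ ((ε * b) * 2)
        simp only [map_mul, map_ofNat]
        exact mul_pos hb (by norm_num)
    rw [posDef_diagonal_iff]
    intro i
    exact key _
  · right
    have key : ∀ j : Fin 2 ⊕ Fin 2,
        0 < -(σ (Sum.elim ![a * (2 * q.n), a * 2] ![(ε * b) * (2 * q.n), (ε * b) * 2] j)) := by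
      rintro (j | j) <;> fin_cases j
      · show 0 < -(σ (a * (2 * q.n)))
        simp only [map_mul, map_ofNat]
        nlinarith [mul_pos (neg_pos.mpr ha) hn]
      · show 0 < -(σ (a * 2))
        simp only [map_mul, map_ofNat]
        linarith
      · show 0 < -(σ ((ε * b) * (2 * q.n)))
        simp only [map_mul, map_ofNat]
        nlinarith [mul_pos (neg_pos.mpr hb) hn]
      · show 0 < -(σ ((ε * b) * 2))
        simp only [map_mul, map_ofNat]
        linarith
    rw [diagonal_neg, posDef_diagonal_iff]
    intro i
    exact key _

/-- **the row plane is totally definite** over a totally real field, for a trace-zero datum with `n` totally positive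
and `a, εb` of the same sign at every real embedding. -/
theorem isTotallyDefinite_ofLinesRow [NumberField k] [IsTotallyReal k] (a b ε : k) (ht : q.t = 0)
    (hn : ∀ σ : k →+* ℝ, 0 < σ q.n)
    (hpos : ∀ σ : k →+* ℝ, (0 < σ a ∧ 0 < σ (ε * b)) ∨ (σ a < 0 ∧ σ (ε * b) < 0)) :
    IsTotallyDefinite (PlaneData.ofLinesRow q a b ε) :=
  ⟨inferInstance, fun σ => posDef_or_negDef_ofLinesRow q a b ε ht σ (hn σ) (hpos σ)⟩

end RowPlane

section CMField

variable {E : Type} [Field E] [NumberField E] [IsCMField E]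

/-- **L1's CM seesaw plane `⟨a⟩ ⊕ ⟨b⟩` is totally definite** when the line scalars `a, b ∈ E⁺` have the same sign at
every real embedding of `E⁺` (`E⁺` totally real: Mathlib; `δ` totally positive: `cmDelta_pos`). -/
theorem isTotallyDefinite_ofLinesRow_cmQuad (ω : E) (hω : ω ≠ 0) (h : IsCMField.complexConj E ω = -ω)
    (a b : maximalRealSubfield E)
    (hpos : ∀ σ : maximalRealSubfield E →+* ℝ, (0 < σ a ∧ 0 < σ b) ∨ (σ a < 0 ∧ σ b < 0)) :
    IsTotallyDefinite (PlaneData.ofLinesRow (cmQuad ω h) a b 1) := by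
  refine isTotallyDefinite_ofLinesRow (cmQuad ω h) a b 1 rfl (fun σ => cmDelta_pos ω hω h σ) fun σ => ?_
  simpa only [one_mul] using hpos σ

/-- **non-vacuity**: every CM field `E` has a totally definite AND genuine seesaw plane over `E⁺` — `⟨1⟩ ⊕ ⟨1⟩`
on the trace-zero datum of `exists_complexConj_eq_neg` (the sign condition is trivial for `a = b = 1`). -/
theorem exists_isTotallyDefinite_isGenuineRow (E : Type) [Field E] [NumberField E] [IsCMField E] :
    ∃ W : PlaneData (maximalRealSubfield E), IsTotallyDefinite W ∧ IsGenuineRow W := by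
  obtain ⟨ω, hω, h⟩ := exists_complexConj_eq_neg E
  refine ⟨PlaneData.ofLinesRow (cmQuad ω h) 1 1 1,
    isTotallyDefinite_ofLinesRow_cmQuad ω hω h 1 1 fun σ => Or.inl ⟨?_, ?_⟩, ?_⟩
  · rw [map_one]; exact zero_lt_one
  · rw [map_one]; exact zero_lt_one
  · exact isGenuineRow_ofLinesRow (cmQuad ω h) 1 1 1 one_ne_zero one_ne_zero one_ne_zero rfl
      (cmDelta_not_isSquare ω hω h)

/-- **`K_f(N) × G(k_∞)` is compact on L1's CM plane** under the sign condition (`N ≠ 0`). -/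
theorem isCompact_finLevel_cmQuad (ω : E) (hω : ω ≠ 0) (h : IsCMField.complexConj E ω = -ω)
    (a b : maximalRealSubfield E)
    (hpos : ∀ σ : maximalRealSubfield E →+* ℝ, (0 < σ a ∧ 0 < σ b) ∨ (σ a < 0 ∧ σ b < 0)) {N : ℕ} (hN : N ≠ 0) :
    IsCompact (finLevel (PlaneData.ofLinesRow (cmQuad ω h) a b 1) N :
      Set (GA (PlaneData.ofLinesRow (cmQuad ω h) a b 1))) :=
  isCompact_finLevel_of_totallyDefinite _ (isTotallyDefinite_ofLinesRow_cmQuad ω hω h a b hpos) hN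

/-- `1_{K_f(N) × G(k_∞)}` is a test function on L1's CM plane under the sign condition. -/
theorem isTest_indicator_finLevel_cmQuad (ω : E) (hω : ω ≠ 0) (h : IsCMField.complexConj E ω = -ω)
    (a b : maximalRealSubfield E)
    (hpos : ∀ σ : maximalRealSubfield E →+* ℝ, (0 < σ a ∧ 0 < σ b) ∨ (σ a < 0 ∧ σ b < 0)) {N : ℕ} (hN : N ≠ 0) :
    RTF.IsTest (Set.indicator (finLevel (PlaneData.ofLinesRow (cmQuad ω h) a b 1) N :
      Set (GA (PlaneData.ofLinesRow (cmQuad ω h) a b 1))) fun _ => (1 : ℂ)) :=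
  isTest_indicator_finLevel_of_totallyDefinite _ (isTotallyDefinite_ofLinesRow_cmQuad ω hω h a b hpos) hN

variable (ω : E) (hω : ω ≠ 0) (h : IsCMField.complexConj E ω = -ω) (a b : maximalRealSubfield E)
  (hdef : IsDefinite (PlaneData.ofLinesRow (cmQuad ω h) a b 1))
  (hgen : IsGenuineRow (PlaneData.ofLinesRow (cmQuad ω h) a b 1))
  [MeasurableSpace (GA (PlaneData.ofLinesRow (cmQuad ω h) a b 1))]
  [BorelSpace (GA (PlaneData.ofLinesRow (cmQuad ω h) a b 1))]
  (R : RTFData (PlaneData.ofLinesRow (cmQuad ω h) a b 1))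
  (μ : Measure (GA (PlaneData.ofLinesRow (cmQuad ω h) a b 1))) [μ.IsHaarMeasure]
  [R.μT.IsHaarMeasure] [R.μT'.IsHaarMeasure] (hT : IsCompact (closure R.DT)) (hT' : IsCompact (closure R.DT'))
  {τ : ℕ → Set (GA (PlaneData.ofLinesRow (cmQuad ω h) a b 1) → ℂ)}
  {φ : ℕ → GA (PlaneData.ofLinesRow (cmQuad ω h) a b 1) → ℂ} {n : ℕ → ℕ}
  {Form : Type} [AddCommGroup Form] [Module ℂ Form] {A : FormAlgebra Form} {Wt : Witness A}

include hω in
/-- **(S1b) FOR THE CONCRETE SPHERICAL PAIRS ON L1's CM PLANE `⟨a⟩ ⊕ ⟨b⟩`** (the theorem of record of this file):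
under the sign condition on `a, b`, if every first test is `1_{K_f(N γ) × G(k_∞)} · (archMat pl (w γ) ·) (i γ) (j γ)`
with `N γ ≠ 0`, every Hecke choice has a finite spectrum. -/
theorem exists_spec_of_archCoeff_cmQuad
    (hpos : ∀ σ : maximalRealSubfield E →+* ℝ, (0 < σ a ∧ 0 < σ b) ∨ (σ a < 0 ∧ σ b < 0))
    (hB : (Setting.ofAdelic (PlaneData.ofLinesRow (cmQuad ω h) a b 1) hdef hgen R μ hT hT').IsAdaptedONB τ φ n)
    (tf : Wt.Translates → (GA (PlaneData.ofLinesRow (cmQuad ω h) a b 1) → ℂ) ×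
      (GA (PlaneData.ofLinesRow (cmQuad ω h) a b 1) → ℂ))
    (N : Wt.Translates → ℕ) (hN : ∀ γ, N γ ≠ 0) (w : Wt.Translates → InfinitePlace (maximalRealSubfield E))
    (i j : Wt.Translates → Fin 4)
    (htf : ∀ γ, (tf γ).1 = RTF.coeffFn (archMat (PlaneData.ofLinesRow (cmQuad ω h) a b 1) (w γ)) (i γ) (j γ)
      (Set.indicator (finLevel (PlaneData.ofLinesRow (cmQuad ω h) a b 1) (N γ) :
        Set (GA (PlaneData.ofLinesRow (cmQuad ω h) a b 1))) fun _ => (1 : ℂ))) :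
    ∃ spec : Wt.Translates → Finset ℕ,
      FiniteSpectrum (Setting.ofAdelic (PlaneData.ofLinesRow (cmQuad ω h) a b 1) hdef hgen R μ hT hT') R.chi R.chi'
        φ n tf spec :=
  exists_spec_of_archCoeff_of_totallyDefinite _ hdef hgen R μ hT hT'
    (isTotallyDefinite_ofLinesRow_cmQuad ω hω h a b hpos) hB tf N hN w i j htf

end CMField

end Summit.Ventures.HodgeRepro.Tier4.Line1

end
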